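import Mathlib
import HarnessLib
import Summits.HubbardSuperconductivity.HubbardSuperconductivity.Theorems.KLProgrammeC4aPPKernelTrueProductForm

/-!
# Route `KLProgramme` — crux C4a, S3 brick (B4) «(B4)-UMK1», «(M1)-TRUE-KERNEL» for the (U1)-LAWS INTERFACE: the ONE-CALL package — the true split kernel
# `K_e(u) = P(e,u)·κ(e/(e+|u|))` satisfies `hK` (C¹), `hK0`, `hK1` of `…C4aFoldBoxTwoSidedLaw` at EVERY signed partner level, with explicit T- and Λ-free constants

Cell `gate-hubbard-kl`, seat hubbard-kl-k3c3-p1 (g15; row «δμ-flow with klAngularMean constant piece»).  Conclusion of the (U1)-interface series `…TrueEnvelope`, `…TrueSigned`,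
`…TrueNumeratorD2`, `…TrueSignedDeriv`, `…TrueProductForm` (memo `M1-TRUE-KERNEL.md` §7–§9; stub (C) of stmt-HubbardSuperconductivity-20437).
* §1 the split weight `S_e(u) = κ(e/(e+|u|))`: `splitArg` facts (`∈ (0,1]`), `splitWeight_eq_zero_of_abs_le` (`|u| ≤ e(1−t₁) ⟹ S = 0`: identically zero near `u = 0`),
  `hasDerivAt_splitArg` (`u ≠ 0`: `d/du[e/(e+|u|)] = −e·sgn(u)/(e+|u|)²`), `hasDerivAt_splitWeight` / `hasDerivAt_splitWeight_zero`, `abs_deriv_splitWeight_le`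
  (`|S′(u)| ≤ κ₁·(max e |u|)⁻¹`), `contDiff_one_splitWeight`, `splitWeight_ne_zero_support` (`S(u) ≠ 0 ⟹ min(1,(1−t₁)/t₁)·e ≤ |u|`);
* §2 def `ppSplitKernel β Λ κ e u = P(e,u)·S_e(u)`; **`contDiff_one_ppSplitKernel`** (`hK`), **`abs_ppSplitKernel_le`** (`hK0`: `≤ κ₀(12B₁+9)·(max e |u|)⁻¹`),
  **`abs_deriv_ppSplitKernel_le`** (`hK1`: `≤ (κ₀·(64B₂+96B₁+136+(12B₁+9)/c) + κ₁(12B₁+9))·(max e |u|)⁻¹²`, `c = min(1,(1−t₁)/t₁)`), for all `u ∈ ℝ`, `0 < e`.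
Hypotheses: `0 < β`, `0 < Λ`, `|χ′| ≤ B₁`, `|χ″| ≤ B₂`; `κ ∈ C¹` (`HasDerivAt κ (κ′ t) t`, `κ′` continuous), `|κ| ≤ κ₀`, `|κ′| ≤ κ₁` on `[0,1]`, `κ = 0` on `[t₁,∞)`, `0 < t₁ < 1`.
After dividing `K_e` by the constant the law's `hK0`/`hK1` hold VERBATIM (the law is linear in `K`).  Pure real analysis; nothing asserts (C), K3 or superconductivity.
References: BGM 2006 §2.4 (2.36) [cite: BenfattoGiulianiMastropietro2006]; FST 1998 §3 [cite: FeldmanSalmhoferTrubowitz1998].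
-/

noncomputable section

namespace Summit.HubbardSuperconductivity.HubbardSuperconductivity.Theorems.C4a

set_option linter.dupNamespace false -- summit = problem name (single-conjunct summit), D-0017

open Real Filter Set
open scoped Topology
open Literature.MathematicalPhysics.QuantumLattice Literature.Analysis.SpecialFunctions

/-! ## §1 The split weight `κ(e/(e+|u|))` -/

/-- `e/(e+|u|) ∈ (0, 1]` for `e > 0`. [folklore] -/
theorem splitArg_mem {e : ℝ} (he : 0 < e) (u : ℝ) : 0 < e / (e + |u|) ∧ e / (e + |u|) ≤ 1 ∧ e / (e + |u|) ∈ Icc (0 : ℝ) 1 := by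
  have hs : 0 < e + |u| := by positivity
  have h1 : 0 < e / (e + |u|) := div_pos he hs
  have h2 : e / (e + |u|) ≤ 1 := (div_le_one hs).2 (by linarith [abs_nonneg u])
  exact ⟨h1, h2, ⟨h1.le, h2⟩⟩

/-- **Near `u = 0` the split weight vanishes**: `|u| ≤ e(1−t₁)`, `t₁ ≤ 1` ⟹ `t₁ ≤ e/(e+|u|)` ⟹ `κ(e/(e+|u|)) = 0`. [folklore] -/
theorem splitWeight_eq_zero_of_abs_le {κ : ℝ → ℝ} {t₁ e u : ℝ} (he : 0 < e) (ht₁ : t₁ ≤ 1) (hκs : ∀ t, t₁ ≤ t → κ t = 0) (hu : |u| ≤ e * (1 - t₁)) :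
    κ (e / (e + |u|)) = 0 := by
  refine hκs _ ?_
  rw [le_div_iff₀ (by positivity)]
  nlinarith [abs_nonneg u]

/-- `d/du[e/(e+|u|)] = −e·sgn(u)/(e+|u|)²` at `u ≠ 0`. [folklore] -/
theorem hasDerivAt_splitArg {e u : ℝ} (he : 0 < e) (hu : u ≠ 0) :
    HasDerivAt (fun v : ℝ => e / (e + |v|)) (-(e * (SignType.sign u : ℝ)) / (e + |u|) ^ 2) u := by
  have h1 : HasDerivAt (fun v : ℝ => e + |v|) (SignType.sign u : ℝ) u := by
    simpa using (hasDerivAt_abs hu).const_add e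
  have h2 := (h1.inv (by positivity : e + |u| ≠ 0)).const_mul e
  refine (h2.congr_of_eventuallyEq (Eventually.of_forall fun v => by simp [div_eq_mul_inv])).congr_deriv ?_
  field_simp

/-- `|sgn u| ≤ 1`. [folklore] -/
theorem abs_sign_coe_le_one (u : ℝ) : |(SignType.sign u : ℝ)| ≤ 1 := by
  generalize SignType.sign u = s
  rcases s <;> simp

/-- The split weight's derivative at `u ≠ 0`. [folklore] -/
theorem hasDerivAt_splitWeight {κ κ' : ℝ → ℝ} (hκ : ∀ t, HasDerivAt κ (κ' t) t) {e u : ℝ} (he : 0 < e) (hu : u ≠ 0) :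
    HasDerivAt (fun v : ℝ => κ (e / (e + |v|))) (κ' (e / (e + |u|)) * (-(e * (SignType.sign u : ℝ)) / (e + |u|) ^ 2)) u :=
  (hκ _).comp u (hasDerivAt_splitArg he hu)

/-- The split weight's derivative at `u = 0` is `0` (it vanishes identically on `|u| ≤ e(1−t₁)`). [folklore] -/
theorem hasDerivAt_splitWeight_zero {κ : ℝ → ℝ} {t₁ e : ℝ} (he : 0 < e) (ht₁ : t₁ < 1) (hκs : ∀ t, t₁ ≤ t → κ t = 0) :
    HasDerivAt (fun v : ℝ => κ (e / (e + |v|))) 0 0 := by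
  have hr : 0 < e * (1 - t₁) := mul_pos he (by linarith)
  have hev : (fun v : ℝ => κ (e / (e + |v|))) =ᶠ[𝓝 0] fun _ => 0 := by
    filter_upwards [Metric.ball_mem_nhds (0 : ℝ) hr] with v hv
    rw [Metric.mem_ball, dist_zero_right, Real.norm_eq_abs] at hv
    exact splitWeight_eq_zero_of_abs_le he ht₁.le hκs hv.le
  exact (hasDerivAt_const (0 : ℝ) (0 : ℝ)).congr_of_eventuallyEq hev

/-- **`|S′(u)| ≤ κ₁·(max e |u|)⁻¹`** (`|κ′| ≤ κ₁` on `[0,1]`; `e/(e+|u|)² ≤ (e+|u|)⁻¹ ≤ (max e |u|)⁻¹`). [folklore] -/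
theorem abs_deriv_splitWeight_le {κ κ' : ℝ → ℝ} {κ₁ t₁ : ℝ} (hκ : ∀ t, HasDerivAt κ (κ' t) t) (hκ'b : ∀ t ∈ Icc 0 1, |κ' t| ≤ κ₁) (ht₁ : t₁ < 1)
    (hκs : ∀ t, t₁ ≤ t → κ t = 0) {e : ℝ} (he : 0 < e) (u : ℝ) : |deriv (fun v : ℝ => κ (e / (e + |v|))) u| ≤ κ₁ * (max e |u|)⁻¹ := by
  have hκ₁ : 0 ≤ κ₁ := (abs_nonneg _).trans (hκ'b 0 (left_mem_Icc.2 zero_le_one))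
  have hM : 0 < max e |u| := he.trans_le (le_max_left _ _)
  rcases eq_or_ne u 0 with rfl | hu
  · rw [(hasDerivAt_splitWeight_zero he ht₁ hκs).deriv, abs_zero]; positivity
  · rw [(hasDerivAt_splitWeight hκ he hu).deriv, abs_mul]
    have hs : 0 < e + |u| := by positivity
    have hk := hκ'b _ (splitArg_mem he u).2.2
    have hg : |-(e * (SignType.sign u : ℝ)) / (e + |u|) ^ 2| ≤ (max e |u|)⁻¹ := by
      rw [abs_div, abs_neg, abs_mul, abs_of_pos he, abs_of_pos (pow_pos hs 2)]
      have h1 : e * |(SignType.sign u : ℝ)| ≤ e := by nlinarith [abs_sign_coe_le_one u, abs_nonneg (SignType.sign u : ℝ)]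
      have hmax : max e |u| ≤ e + |u| := max_le (by linarith [abs_nonneg u]) (by linarith)
      calc e * |(SignType.sign u : ℝ)| / (e + |u|) ^ 2 ≤ e / (e + |u|) ^ 2 := div_le_div_of_nonneg_right h1 (pow_pos hs 2).le
        _ ≤ 1 / (e + |u|) := by rw [div_le_div_iff₀ (pow_pos hs 2) hs]; nlinarith [abs_nonneg u]
        _ ≤ 1 / max e |u| := one_div_le_one_div_of_le hM hmax
        _ = (max e |u|)⁻¹ := one_div _
    exact mul_le_mul hk hg (abs_nonneg _) hκ₁

/-- **The split weight is `C¹`** (composition away from `u = 0`, identically zero near it). [folklore] -/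
theorem contDiff_one_splitWeight {κ κ' : ℝ → ℝ} {t₁ : ℝ} (hκ : ∀ t, HasDerivAt κ (κ' t) t) (hκ'c : Continuous κ') (ht₁ : t₁ < 1) (hκs : ∀ t, t₁ ≤ t → κ t = 0)
    {e : ℝ} (he : 0 < e) : ContDiff ℝ 1 (fun v : ℝ => κ (e / (e + |v|))) := by
  have hκC : ContDiff ℝ 1 κ := by
    rw [contDiff_one_iff_deriv]
    have hd : deriv κ = κ' := funext fun t => (hκ t).deriv
    exact ⟨fun t => (hκ t).differentiableAt, by rw [hd]; exact hκ'c⟩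
  refine contDiff_iff_contDiffAt.2 fun u => ?_
  rcases eq_or_ne u 0 with rfl | hu
  · have hr : 0 < e * (1 - t₁) := mul_pos he (by linarith)
    have hev : (fun v : ℝ => κ (e / (e + |v|))) =ᶠ[𝓝 0] fun _ => 0 := by
      filter_upwards [Metric.ball_mem_nhds (0 : ℝ) hr] with v hv
      rw [Metric.mem_ball, dist_zero_right, Real.norm_eq_abs] at hv
      exact splitWeight_eq_zero_of_abs_le he ht₁.le hκs hv.le
    exact contDiffAt_const.congr_of_eventuallyEq hev
  · have hg : ContDiffAt ℝ 1 (fun v : ℝ => e / (e + |v|)) u :=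
      contDiffAt_const.div (contDiffAt_const.add (contDiffAt_abs hu)) (by positivity)
    exact (hκC.contDiffAt).comp u hg

/-- **On the split's support the partner level dominates**: `κ(e/(e+|u|)) ≠ 0`, `0 < t₁` ⟹ `min(1,(1−t₁)/t₁)·e ≤ |u|`. [folklore] -/
theorem splitWeight_ne_zero_support {κ : ℝ → ℝ} {t₁ e u : ℝ} (he : 0 < e) (ht₀ : 0 < t₁) (hκs : ∀ t, t₁ ≤ t → κ t = 0) (hS : κ (e / (e + |u|)) ≠ 0) :
    min 1 ((1 - t₁) / t₁) * e ≤ |u| := by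
  have hs : 0 < e + |u| := by positivity
  have hlt : e / (e + |u|) < t₁ := by
    by_contra h
    exact hS (hκs _ (not_lt.1 h))
  rw [div_lt_iff₀ hs] at hlt
  have h1 : (1 - t₁) / t₁ * e ≤ |u| := by
    rw [div_mul_eq_mul_div, div_le_iff₀ ht₀]; nlinarith
  exact (mul_le_mul_of_nonneg_right (min_le_right _ _) he.le).trans h1

/-! ## §2 The split kernel and the three (U1)-LAWS hypotheses -/

/-- **The true split kernel** `K_e(u) = P(e,u)·κ(e/(e+|u|))`. -/
def ppSplitKernel (β Λ : ℝ) (κ : ℝ → ℝ) (e u : ℝ) : ℝ := ppTrueKernel β Λ e u * κ (e / (e + |u|))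

/-- **`hK`: `u ↦ K_e(u)` is `C¹`.** [cite: BenfattoGiulianiMastropietro2006, §2.4 (2.36)] -/
theorem contDiff_one_ppSplitKernel {β Λ : ℝ} (hβ : 0 < β) (hΛ : 0 < Λ) {B₁ : ℝ} (hB₁ : ∀ x, |deriv salmhoferCutoff x| ≤ B₁) {κ κ' : ℝ → ℝ} {t₁ : ℝ}
    (hκ : ∀ t, HasDerivAt κ (κ' t) t) (hκ'c : Continuous κ') (ht₁ : t₁ < 1) (hκs : ∀ t, t₁ ≤ t → κ t = 0) {e : ℝ} (he : 0 < e) :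
    ContDiff ℝ 1 (fun u : ℝ => ppSplitKernel β Λ κ e u) :=
  (contDiff_one_ppTrueKernel hβ hΛ hB₁ e).mul (contDiff_one_splitWeight hκ hκ'c ht₁ hκs he)

/-- **`hK0`: `|K_e(u)| ≤ κ₀(12B₁+9)·(max e |u|)⁻¹` for every `u`.** [cite: BenfattoGiulianiMastropietro2006, §2.4 (2.36)] -/
theorem abs_ppSplitKernel_le {β Λ : ℝ} (hβ : 0 < β) (hΛ : 0 < Λ) {B₁ : ℝ} (hB₁ : ∀ x, |deriv salmhoferCutoff x| ≤ B₁) {κ : ℝ → ℝ} {κ₀ : ℝ}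
    (hκb : ∀ t ∈ Icc 0 1, |κ t| ≤ κ₀) {e : ℝ} (he : 0 < e) (u : ℝ) : |ppSplitKernel β Λ κ e u| ≤ κ₀ * (12 * B₁ + 9) * (max e |u|)⁻¹ := by
  have hB0 := salmhoferB₁_nonneg hB₁
  have hκ₀ : 0 ≤ κ₀ := (abs_nonneg _).trans (hκb 0 (left_mem_Icc.2 zero_le_one))
  have hM : 0 < max e |u| := he.trans_le (le_max_left _ _)
  unfold ppSplitKernel
  rw [abs_mul]
  have hP := abs_ppTrueKernel_le_inv_max hβ hΛ hB₁ he u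
  have hk := hκb _ (splitArg_mem he u).2.2
  calc |ppTrueKernel β Λ e u| * |κ (e / (e + |u|))| ≤ (12 * B₁ + 9) * (max e |u|)⁻¹ * κ₀ := mul_le_mul hP hk (abs_nonneg _) (by positivity)
    _ = κ₀ * (12 * B₁ + 9) * (max e |u|)⁻¹ := by ring

/-- **`hK1`: `|K_e′(u)| ≤ (κ₀(64B₂+96B₁+136+(12B₁+9)/c) + κ₁(12B₁+9))·(max e |u|)⁻¹²` for every `u`, `c = min(1,(1−t₁)/t₁)`** — the product rule; on the
split's support `c·e ≤ |u|` so `…TrueProductForm.abs_ppTrueKernelDu_le_inv_max_sq` applies, off it the `P′`-term vanishes; `|S′| ≤ κ₁·(max e |u|)⁻¹`.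
[cite: BenfattoGiulianiMastropietro2006, §2.4 (2.36)] -/
theorem abs_deriv_ppSplitKernel_le {β Λ : ℝ} (hβ : 0 < β) (hΛ : 0 < Λ) {B₁ B₂ : ℝ} (hB₁ : ∀ x, |deriv salmhoferCutoff x| ≤ B₁)
    (hB₂ : ∀ x, |deriv (deriv salmhoferCutoff) x| ≤ B₂) {κ κ' : ℝ → ℝ} {κ₀ κ₁ t₁ : ℝ} (hκ : ∀ t, HasDerivAt κ (κ' t) t)
    (hκb : ∀ t ∈ Icc 0 1, |κ t| ≤ κ₀) (hκ'b : ∀ t ∈ Icc 0 1, |κ' t| ≤ κ₁) (ht₀ : 0 < t₁) (ht₁ : t₁ < 1) (hκs : ∀ t, t₁ ≤ t → κ t = 0)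
    {e : ℝ} (he : 0 < e) (u : ℝ) :
    |deriv (fun v : ℝ => ppSplitKernel β Λ κ e v) u| ≤
      (κ₀ * (64 * B₂ + 96 * B₁ + 136 + (12 * B₁ + 9) / min 1 ((1 - t₁) / t₁)) + κ₁ * (12 * B₁ + 9)) * (max e |u|)⁻¹ ^ 2 := by
  have hB0 := salmhoferB₁_nonneg hB₁
  have hB20 : 0 ≤ B₂ := (abs_nonneg _).trans (hB₂ 0)
  have hκ₀ : 0 ≤ κ₀ := (abs_nonneg _).trans (hκb 0 (left_mem_Icc.2 zero_le_one))
  have hκ₁ : 0 ≤ κ₁ := (abs_nonneg _).trans (hκ'b 0 (left_mem_Icc.2 zero_le_one))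
  have hM : 0 < max e |u| := he.trans_le (le_max_left _ _)
  set c : ℝ := min 1 ((1 - t₁) / t₁) with hc
  have hc0 : 0 < c := lt_min one_pos (div_pos (by linarith) ht₀)
  have hc1 : c ≤ 1 := min_le_left _ _
  set C₁ : ℝ := 64 * B₂ + 96 * B₁ + 136 + (12 * B₁ + 9) / c with hC₁
  have hC₁0 : 0 ≤ C₁ := by positivity
  -- the derivative of the product
  have hP := hasDerivAt_ppTrueKernel_u hβ hΛ hB₁ e u
  have hSd : HasDerivAt (fun v : ℝ => κ (e / (e + |v|))) (deriv (fun v : ℝ => κ (e / (e + |v|))) u) u := by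
    rcases eq_or_ne u 0 with rfl | hu
    · rw [(hasDerivAt_splitWeight_zero he ht₁ hκs).deriv]; exact hasDerivAt_splitWeight_zero he ht₁ hκs
    · rw [(hasDerivAt_splitWeight hκ he hu).deriv]; exact hasDerivAt_splitWeight hκ he hu
  have hK := hP.mul hSd
  have hKd : deriv (fun v : ℝ => ppSplitKernel β Λ κ e v) u =
      ppTrueKernelDu β Λ e u * κ (e / (e + |u|)) + ppTrueKernel β Λ e u * deriv (fun v : ℝ => κ (e / (e + |v|))) u := by
    have := hK.deriv
    unfold ppSplitKernel
    exact this
  rw [hKd]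
  -- term 1: `P′·S` — vanishes off the support, envelope on it
  have hk := hκb _ (splitArg_mem he u).2.2
  have h1 : |ppTrueKernelDu β Λ e u * κ (e / (e + |u|))| ≤ κ₀ * C₁ * (max e |u|)⁻¹ ^ 2 := by
    by_cases hS : κ (e / (e + |u|)) = 0
    · rw [hS, mul_zero, abs_zero]; positivity
    · have hsupp : c * e ≤ |u| := splitWeight_ne_zero_support he ht₀ hκs hS
      have hPd := abs_ppTrueKernelDu_le_inv_max_sq hβ hΛ hB₁ hB₂ hc0 hc1 he hsupp
      rw [abs_mul]
      calc |ppTrueKernelDu β Λ e u| * |κ (e / (e + |u|))| ≤ C₁ * (max e |u|)⁻¹ ^ 2 * κ₀ := mul_le_mul hPd hk (abs_nonneg _) (by positivity)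
        _ = κ₀ * C₁ * (max e |u|)⁻¹ ^ 2 := by ring
  -- term 2: `P·S′`
  have h2 : |ppTrueKernel β Λ e u * deriv (fun v : ℝ => κ (e / (e + |v|))) u| ≤ κ₁ * (12 * B₁ + 9) * (max e |u|)⁻¹ ^ 2 := by
    rw [abs_mul]
    have hPv := abs_ppTrueKernel_le_inv_max hβ hΛ hB₁ he u
    have hS' := abs_deriv_splitWeight_le hκ hκ'b ht₁ hκs he u
    calc |ppTrueKernel β Λ e u| * |deriv (fun v : ℝ => κ (e / (e + |v|))) u| ≤ (12 * B₁ + 9) * (max e |u|)⁻¹ * (κ₁ * (max e |u|)⁻¹) :=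
          mul_le_mul hPv hS' (abs_nonneg _) (by positivity)
      _ = κ₁ * (12 * B₁ + 9) * (max e |u|)⁻¹ ^ 2 := by ring
  calc _ ≤ _ := abs_add_le _ _
    _ ≤ κ₀ * C₁ * (max e |u|)⁻¹ ^ 2 + κ₁ * (12 * B₁ + 9) * (max e |u|)⁻¹ ^ 2 := add_le_add h1 h2
    _ = (κ₀ * C₁ + κ₁ * (12 * B₁ + 9)) * (max e |u|)⁻¹ ^ 2 := by ring

end Summit.HubbardSuperconductivity.HubbardSuperconductivity.Theorems.C4a

end
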